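import Literature.Probability.RandomPlanarGeometry.SLEBubblesConfig
import HarnessLib

/-!
# The closed filling `F^ℝ_ℍ(cl(γ(0, ∞) ∪ ⋃ X̂)) ∩ ℍ` of SLE_κ with its bubbles, and its membership in `Ω` ([LSW] Thm. 7.3 read as in Thm. 8.4)

Companion of `Literature.Probability.RandomPlanarGeometry.SLEBubbles` ([LSW] §7.2) and
`SLEBubblesConfig`, after

* G. F. Lawler, O. Schramm, W. Werner, *Conformal restriction: the chordal case*, J. Amer. Math.
  Soc. **16** (2003) 917–955, arXiv:math/0209343 (**[LSW]**, arXiv page numbers), Def. 3.1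
  (p. 10, the space `Ω`), §7.2 (p. 28: "`Ξ = Ξ(κ) := F^ℝ_ℍ(γ(0, ∞) ∪ ⋃ X̂)`"), Thm. 7.3 (p. 29:
  "the law of `Ξ(κ)` is `P_{α_κ}`", whose proof ends with "all that remains is to show that
  `cl Ξ = Ξ ∪ {0}`") and Thm. 8.4 (p. 37: "let `K = F^{ℝ₊}_ℍ(cl K_∞)` … Then `K` satisfies the
  right-sided restriction property").

PURPOSE. The named fact `SLEBubbles.exists_measurable_version` ("`Ξ(κ)` has a measurable
`Ω`-valued version EQUAL to `Ξ(κ)` a.s.") contains the closedness statement `cl Ξ = Ξ ∪ {0}` of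
p. 29, whose printed proof uses the strong Markov property of SLE jointly with the bubble cloud
and the estimate of Lemma 7.2; none of its dependents in the tree (existence of `P_α`, `α ≥ 5/8`;
`P_α`-a.e. interior points, `α > 5/8`; [LSW] p. 5 results 1–2) needs more than SOME measurable
`Ω`-valued random set CONTAINING `Ξ(κ)` with law `P_{α_κ}`. Following the paper's own convention
in Thm. 8.4 (the filling of the CLOSURE; its tree analogue `SLEKappaRho.exists_measurable_fill_version`
is proved), this file introduces that set,

* `Literature.Probability.RandomPlanarGeometry.sleClosedBubbleSet κ ω X` — **the closed filling**
  `F^ℝ_ℍ(cl(γ(0, ∞) ∪ ⋃ X̂)) ∩ ℍ` (`sleBubbleUnion` = `γ(0, ∞) ∪ ⋃ X̂`, so that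
  `sleBubbleSet = F^ℝ_ℍ(sleBubbleUnion)`); it contains `Ξ(κ)`
  (`sleBubbleSet_subset_sleClosedBubbleSet`) and equals it a.s. by the (unused) closedness
  statement of p. 29;

and PROVES, deterministically in the sample (`sleClosedBubbleSet_mem_restrictionConfigs`), that it
belongs to `Ω` as soon as the trace is a simple path in `ℍ ∪ {0}`, no bubble sits at time `0`, and
`cl(γ(0, ∞) ∪ ⋃ X̂)` meets `ℝ` at most at `0` (the printed statement "`cl Ξ ∩ (ℝ ∖ {0}) = ∅` a.s."
of p. 29, which follows from (7.3): `SLEBubblesRealLine`). The topology of the two-sided filling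
`F^ℝ_ℍ` (`twoSidedFilling`, file `SLEBubbles`) needed for this:

* `twoSidedFilling_mono`; `mem_of_ofReal_mem_twoSidedFilling` (real points of `F^ℝ_ℍ(S)` lie in
  `S`); `isClosed_twoSidedFilling` (**`F^ℝ_ℍ` of a closed set is closed**: the removed
  components of `ℍ̄ ∖ S` are relatively open);
* `disjoint_twoSidedFilling_of_forall_disjoint_ball` — **chain lemma**: if `T` misses all
  half-balls `B(a, δ) ∩ ℍ̄`, `a ∈ A`, about the points of a `*`-hull `A`, then `F^ℝ_ℍ(T) ∩ A = ∅`
  (a bounded hull has no floating pieces, `IsBoundedHull.isConnected_union_im_nonpos`);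
* `isConnected_twoSidedFilling_inter_upperHalfPlaneSet` — `F^ℝ_ℍ(S) ∩ ℍ` is connected for `S`
  closed with `S ∩ ℍ` connected and `S ∩ ℝ ⊆ {0}` (each added component is open and has a frontier
  point off `0`, which lies in `S ∩ ℍ`); `isConnected_compl_twoSidedFilling` — `ℂ ∖ F^ℝ_ℍ(S)` is
  connected (the lower half-plane with the components of the real points hanging on it).

The probabilistic half — law `P_{α_κ}` and the measurable version from (7.3) alone — is
`SLEBubblesClosedFillLaw`; the `h₁`-free parent assemblies are `SLEBubblesClosedFillAssembly`.

Mathlib: `connectedComponentIn` API, `isPreconnected_of_forall`, `IsPreconnected.subset_connectedComponentIn`,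
`isConnected_compl_singleton_of_one_lt_rank`, `Complex.closure_setOf_im_lt`.
-/

noncomputable section

open Set Filter Topology Metric Bornology
open UpperHalfPlane (upperHalfPlaneSet isOpen_upperHalfPlaneSet)
open scoped NNReal

namespace Literature.Probability.RandomPlanarGeometry

/-! ### More topology of the two-sided filling `F^ℝ_ℍ` -/

section Filling

variable {S T A : Set ℂ}

/-- The two-sided filling is monotone. [folklore] -/
theorem twoSidedFilling_mono (h : S ⊆ T) : twoSidedFilling S ⊆ twoSidedFilling T := by
  intro z hz
  rw [mem_twoSidedFilling_iff] at hz ⊢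
  exact ⟨hz.1, fun x hx ↦ hz.2 x (connectedComponentIn_mono (x : ℂ) (sdiff_subset_sdiff_right h) hx)⟩

/-- Real points of `F^ℝ_ℍ(S)` belong to `S` (a real point off `S` lies in its own component of
`ℍ̄ ∖ S`). [folklore] -/
theorem mem_of_ofReal_mem_twoSidedFilling {x : ℝ} (hx : (x : ℂ) ∈ twoSidedFilling S) :
    (x : ℂ) ∈ S := by
  by_contra hxS
  have hxY : (x : ℂ) ∈ {z : ℂ | 0 ≤ z.im} \ S := ⟨by simp, hxS⟩
  exact (mem_twoSidedFilling_iff.1 hx).2 x (mem_connectedComponentIn hxY)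

/-- The real points of `F^ℝ_ℍ(S)` are real points of `S`. [folklore] -/
theorem twoSidedFilling_inter_range_ofReal_subset (S : Set ℂ) :
    twoSidedFilling S ∩ range ((↑) : ℝ → ℂ) ⊆ S ∩ range ((↑) : ℝ → ℂ) := by
  rintro _ ⟨hz, x, rfl⟩
  exact ⟨mem_of_ofReal_mem_twoSidedFilling hz, x, rfl⟩

/-- **The two-sided filling of a closed set is closed**: the removed components of `ℍ̄ ∖ S` are
relatively open in `ℍ̄`. [folklore] -/
theorem isClosed_twoSidedFilling (hS : IsClosed S) : IsClosed (twoSidedFilling S) := by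
  rw [← isOpen_compl_iff, Metric.isOpen_iff]
  intro w hw
  by_cases hwim : 0 ≤ w.im
  · have hw' : ¬ (0 ≤ w.im ∧ ∀ x : ℝ, w ∉ connectedComponentIn ({z : ℂ | 0 ≤ z.im} \ S) x) := by
      rwa [mem_compl_iff, mem_twoSidedFilling_iff] at hw
    push Not at hw'
    obtain ⟨x, hx⟩ := hw' hwim
    have hwY : w ∈ {z : ℂ | 0 ≤ z.im} \ S := connectedComponentIn_subset _ _ hx
    obtain ⟨r, hr, hball⟩ := exists_ball_inter_subset_connectedComponentIn hS (mem_connectedComponentIn hwY)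
    refine ⟨r, hr, fun v hv hvF ↦ ?_⟩
    have hvim : 0 ≤ v.im := (mem_twoSidedFilling_iff.1 hvF).1
    have hvC : v ∈ connectedComponentIn ({z : ℂ | 0 ≤ z.im} \ S) w := hball ⟨hv, hvim⟩
    refine (mem_twoSidedFilling_iff.1 hvF).2 x ?_
    rw [connectedComponentIn_eq hx]
    exact hvC
  · push Not at hwim
    refine ⟨-w.im, by linarith, fun v hv hvF ↦ ?_⟩
    have hvim : 0 ≤ v.im := (mem_twoSidedFilling_iff.1 hvF).1
    rw [mem_ball, dist_eq_norm] at hv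
    have h1 : |(v - w).im| ≤ ‖v - w‖ := Complex.abs_im_le_norm _
    rw [Complex.sub_im] at h1
    have h2 := (abs_le.1 h1).2
    linarith

/-- **Chain lemma.** If a set `T` misses every half-ball `B(a, δ) ∩ ℍ̄`, `a ∈ A`, of a fixed
radius about the points of a `*`-hull `A`, then its filling `F^ℝ_ℍ(T)` misses `A`: the component
of `ℍ̄ ∖ T` containing a point `z ∈ A` swallows the half-balls about the points of `A` it
contains, so if it had no real point these points of `A` would be at height `≥ δ` and
`δ`-separated from the rest of `A`, splitting the connected set `A ∪ {Im ≤ 0}`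
(`IsBoundedHull.isConnected_union_im_nonpos`). [folklore] -/
theorem disjoint_twoSidedFilling_of_forall_disjoint_ball (hA : IsStarHull A) {δ : ℝ} (hδ : 0 < δ)
    (h : ∀ a ∈ A, Disjoint T (ball a δ ∩ {z : ℂ | 0 ≤ z.im})) :
    Disjoint (twoSidedFilling T) A := by
  refine Set.disjoint_right.2 fun z hzA hzF ↦ ?_
  set Y : Set ℂ := {z : ℂ | 0 ≤ z.im} \ T with hY
  have hballY : ∀ a ∈ A, ball a δ ∩ {z : ℂ | 0 ≤ z.im} ⊆ Y := fun a ha v hv ↦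
    ⟨hv.2, fun hvT ↦ Set.disjoint_left.1 (h a ha) hvT hv⟩
  have hAim : ∀ a ∈ A, 0 ≤ a.im := fun a ha ↦ hA.isBoundedHull.im_nonneg ha
  set C : Set ℂ := connectedComponentIn Y z with hC
  have hzY : z ∈ Y := hballY z hzA ⟨mem_ball_self hδ, hAim z hzA⟩
  have hzC : z ∈ C := mem_connectedComponentIn hzY
  -- each half-ball about a point of `A ∩ C` lies in `C`
  have hballC : ∀ a ∈ A, a ∈ C → ball a δ ∩ {z : ℂ | 0 ≤ z.im} ⊆ C := by
    intro a ha haC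
    have hpre : IsPreconnected (ball a δ ∩ {z : ℂ | 0 ≤ z.im}) :=
      ((convex_ball a δ).inter (convex_halfSpace_im_ge 0)).isPreconnected
    have := hpre.subset_connectedComponentIn ⟨mem_ball_self hδ, hAim a ha⟩ (hballY a ha)
    rwa [← connectedComponentIn_eq haC] at this
  -- `C` has no real point (else `z ∉ F T`)
  have hCreal : ∀ w ∈ C, w.im ≠ 0 := by
    intro w hwC hwim
    have hw : ((w.re : ℝ) : ℂ) = w := Complex.ext (by simp) (by simp [hwim])
    refine (mem_twoSidedFilling_iff.1 hzF).2 w.re ?_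
    rw [hw, ← connectedComponentIn_eq hwC]
    exact hzC
  -- points of `A ∩ C` are at height `≥ δ`
  have hhigh : ∀ a ∈ A, a ∈ C → δ ≤ a.im := by
    intro a ha haC
    by_contra hlt
    push Not at hlt
    have hre : ((a.re : ℝ) : ℂ) ∈ ball a δ ∩ {z : ℂ | 0 ≤ z.im} := by
      refine ⟨?_, by simp⟩
      rw [mem_ball, dist_comm, dist_eq_norm]
      have : a - (a.re : ℂ) = (a.im : ℂ) * Complex.I := Complex.ext (by simp) (by simp)
      rw [this, norm_mul, Complex.norm_I, mul_one, Complex.norm_real, Real.norm_eq_abs,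
        abs_of_nonneg (hAim a ha)]
      exact hlt
    exact hCreal _ (hballC a ha haC hre) (by simp)
  -- separation of the connected set `A ∪ {Im ≤ 0}`
  have hconn := hA.isBoundedHull.isConnected_union_im_nonpos
  set O₁ : Set ℂ := ⋃ a ∈ {a ∈ A | a ∈ C}, ball a (δ / 2) with hO₁
  set O₂ : Set ℂ := (⋃ a ∈ {a ∈ A | a ∉ C}, ball a (δ / 2)) ∪ {w : ℂ | w.im < δ / 2} with hO₂
  have hO₁o : IsOpen O₁ := isOpen_biUnion fun _ _ ↦ isOpen_ball
  have hO₂o : IsOpen O₂ :=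
    (isOpen_biUnion fun _ _ ↦ isOpen_ball).union (isOpen_lt Complex.continuous_im continuous_const)
  have hδ2 : 0 < δ / 2 := by positivity
  have hcover : A ∪ {w : ℂ | w.im ≤ 0} ⊆ O₁ ∪ O₂ := by
    rintro w (hwA | hwim)
    · by_cases hwC : w ∈ C
      · exact Or.inl (mem_biUnion (show w ∈ {a ∈ A | a ∈ C} from ⟨hwA, hwC⟩) (mem_ball_self hδ2))
      · exact Or.inr (Or.inl
          (mem_biUnion (show w ∈ {a ∈ A | a ∉ C} from ⟨hwA, hwC⟩) (mem_ball_self hδ2)))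
    · refine Or.inr (Or.inr ?_)
      simp only [mem_setOf_eq] at hwim ⊢
      linarith
  have hdisj : ∀ w ∈ O₁, w ∉ O₂ := by
    intro w hw₁ hw₂
    rw [hO₁, mem_iUnion₂] at hw₁
    obtain ⟨a₁, ⟨ha₁A, ha₁C⟩, hw₁⟩ := hw₁
    rcases hw₂ with hw₂ | hw₂
    · rw [mem_iUnion₂] at hw₂
      obtain ⟨a₂, ⟨ha₂A, ha₂C⟩, hw₂⟩ := hw₂
      refine ha₂C (hballC a₁ ha₁A ha₁C ⟨?_, hAim a₂ ha₂A⟩)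
      rw [mem_ball] at hw₁ hw₂ ⊢
      calc dist a₂ a₁ ≤ dist a₂ w + dist w a₁ := dist_triangle _ _ _
        _ < δ / 2 + δ / 2 := by rw [dist_comm a₂ w]; exact add_lt_add hw₂ hw₁
        _ = δ := by ring
    · have h1 : δ ≤ a₁.im := hhigh a₁ ha₁A ha₁C
      rw [mem_ball, dist_eq_norm] at hw₁
      have h2 : |(w - a₁).im| ≤ ‖w - a₁‖ := Complex.abs_im_le_norm _
      rw [Complex.sub_im] at h2
      have h3 := (abs_le.1 h2).1
      simp only [mem_setOf_eq] at hw₂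
      linarith
  have hz₁ : z ∈ (A ∪ {w : ℂ | w.im ≤ 0}) ∩ O₁ :=
    ⟨Or.inl hzA, mem_biUnion (show z ∈ {a ∈ A | a ∈ C} from ⟨hzA, hzC⟩) (mem_ball_self hδ2)⟩
  have hz₂ : (-Complex.I) ∈ (A ∪ {w : ℂ | w.im ≤ 0}) ∩ O₂ :=
    ⟨Or.inr (by simp), Or.inr (by simp only [mem_setOf_eq, Complex.neg_im, Complex.I_im]; linarith)⟩
  obtain ⟨w, -, hw₁, hw₂⟩ :=
    hconn.isPreconnected O₁ O₂ hO₁o hO₂o hcover ⟨z, hz₁⟩ ⟨-Complex.I, hz₂⟩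
  exact hdisj w hw₁ hw₂

/-- **`F^ℝ_ℍ(S) ∩ ℍ` is connected** for a closed `S ⊆ ℍ̄` with `S ∩ ℍ` connected and no real
point other than `0`: every added component `C` of `ℍ̄ ∖ S` (without real points) is open, and
a frontier point of it off `0` exists (otherwise `cl C ⊇ ℂ ∖ {0}`) and lies in `S ∩ ℍ`, so `C`
hangs on `S ∩ ℍ`. [folklore] -/
theorem isConnected_twoSidedFilling_inter_upperHalfPlaneSet (hS : IsClosed S)
    (hSH : S ⊆ {z : ℂ | 0 ≤ z.im}) (hconn : IsConnected (S ∩ upperHalfPlaneSet))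
    (hS0 : S ∩ range ((↑) : ℝ → ℂ) ⊆ {0}) :
    IsConnected (twoSidedFilling S ∩ upperHalfPlaneSet) := by
  obtain ⟨y, hyS, hyH⟩ := hconn.nonempty
  have hSF : S ⊆ twoSidedFilling S := fun w hw ↦ inter_subset_twoSidedFilling S ⟨hw, hSH hw⟩
  have hSHF : S ∩ upperHalfPlaneSet ⊆ twoSidedFilling S ∩ upperHalfPlaneSet :=
    inter_subset_inter_left _ hSF
  refine ⟨⟨y, hSHF ⟨hyS, hyH⟩⟩, isPreconnected_of_forall y fun z hz ↦ ?_⟩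
  by_cases hzS : z ∈ S
  · exact ⟨S ∩ upperHalfPlaneSet, hSHF, ⟨hyS, hyH⟩, ⟨hzS, hz.2⟩, hconn.isPreconnected⟩
  set Y : Set ℂ := {z : ℂ | 0 ≤ z.im} \ S with hY
  have hzY : z ∈ Y := ⟨(mem_twoSidedFilling_iff.1 hz.1).1, hzS⟩
  set C : Set ℂ := connectedComponentIn Y z with hC
  have hCY : C ⊆ Y := connectedComponentIn_subset _ _
  have hzC : z ∈ C := mem_connectedComponentIn hzY
  have hCpre : IsPreconnected C := isPreconnected_connectedComponentIn
  have key : ∀ {x : ℝ} {w : ℂ}, w ∈ C → w ∉ connectedComponentIn Y x := by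
    intro x w hwC hwx
    refine (mem_twoSidedFilling_iff.1 hz.1).2 x ?_
    rw [connectedComponentIn_eq hwx, ← connectedComponentIn_eq hwC]
    exact hzC
  have hCim : ∀ w ∈ C, 0 < w.im := by
    intro w hwC
    rcases (show (0 : ℝ) ≤ w.im from (hCY hwC).1).eq_or_lt with h | h
    · exfalso
      have hw : ((w.re : ℝ) : ℂ) = w := Complex.ext (by simp) (by simp [← h])
      exact key (x := w.re) hwC (by rw [hw]; exact mem_connectedComponentIn (hCY hwC))
    · exact h
  have hCF : C ⊆ twoSidedFilling S ∩ upperHalfPlaneSet := fun w hwC ↦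
    ⟨mem_twoSidedFilling_iff.2 ⟨(hCY hwC).1, fun x hx ↦ key hwC hx⟩, hCim w hwC⟩
  -- `C` is open
  have hCopen : IsOpen C := by
    refine Metric.isOpen_iff.2 fun w hwC ↦ ?_
    obtain ⟨r, hr, hball⟩ := Metric.isOpen_iff.1 (hS.isOpen_compl.inter isOpen_upperHalfPlaneSet) w
      ⟨(hCY hwC).2, hCim w hwC⟩
    refine ⟨r, hr, ?_⟩
    have hballY : ball w r ⊆ Y := fun v hv ↦
      ⟨le_of_lt (show (0 : ℝ) < v.im from (hball hv).2), (hball hv).1⟩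
    have := (convex_ball w r).isPreconnected.subset_connectedComponentIn (mem_ball_self hr) hballY
    rwa [← connectedComponentIn_eq hwC] at this
  have hfr_eq : frontier C = closure C \ C := by rw [frontier, hCopen.interior_eq]
  -- frontier points of `C` lie in `S`
  have hfront : ∀ w ∈ frontier C, w ∈ S := by
    intro w hw
    rw [hfr_eq] at hw
    obtain ⟨hwcl, hwC⟩ := hw
    by_contra hwS
    have hwim : 0 ≤ w.im :=
      closure_minimal (fun u hu ↦ (hCY hu).1) (isClosed_le continuous_const Complex.continuous_im) hwcl
    obtain ⟨r, hr, hball⟩ := exists_ball_inter_subset_connectedComponentIn hS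
      (mem_connectedComponentIn (show w ∈ Y from ⟨hwim, hwS⟩))
    have hne : (ball w r ∩ C).Nonempty := mem_closure_iff_nhds.1 hwcl (ball w r) (ball_mem_nhds w hr)
    obtain ⟨v, hv⟩ := hne
    have hvball : v ∈ ball w r := hv.1
    have hvC : v ∈ C := hv.2
    have hvw : v ∈ connectedComponentIn Y w := hball ⟨hvball, (hCY hvC).1⟩
    refine hwC ?_
    rw [hC, connectedComponentIn_eq hvC, ← connectedComponentIn_eq hvw]
    exact mem_connectedComponentIn ⟨hwim, hwS⟩
  -- a frontier point off `0`
  have hfne : ∃ w ∈ frontier C, w ≠ 0 := by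
    by_contra hcon
    push Not at hcon
    have hcov : ({0}ᶜ : Set ℂ) ⊆ C ∪ (closure C)ᶜ := by
      intro w hw
      by_cases hwcl : w ∈ closure C
      · left
        by_contra hwC
        have : w ∈ frontier C := by rw [hfr_eq]; exact ⟨hwcl, hwC⟩
        exact hw (hcon w this)
      · exact Or.inr hwcl
    have hpc : IsPreconnected ({0}ᶜ : Set ℂ) :=
      (isConnected_compl_singleton_of_one_lt_rank (by simp) (0 : ℂ)).isPreconnected
    have hz0 : z ≠ 0 := fun h ↦ by
      have := hCim z hzC
      rw [h] at this
      simp at this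
    have hclH : closure C ⊆ {z : ℂ | 0 ≤ z.im} :=
      closure_minimal (fun u hu ↦ (hCY hu).1) (isClosed_le continuous_const Complex.continuous_im)
    have hI : (-Complex.I) ∉ closure C := fun h ↦ by
      have : (0 : ℝ) ≤ (-Complex.I).im := hclH h
      norm_num at this
    obtain ⟨w, -, hwC, hwcl⟩ := hpc C (closure C)ᶜ hCopen isClosed_closure.isOpen_compl hcov
      ⟨z, hz0, hzC⟩ ⟨-Complex.I, by simp, hI⟩
    exact hwcl (subset_closure hwC)
  obtain ⟨w, hwfr, hw0⟩ := hfne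
  have hwS : w ∈ S := hfront w hwfr
  have hwH : w ∈ upperHalfPlaneSet := by
    rcases (show (0 : ℝ) ≤ w.im from hSH hwS).eq_or_lt with h | h
    · exfalso
      have hw : ((w.re : ℝ) : ℂ) = w := Complex.ext (by simp) (by simp [← h])
      have : w ∈ S ∩ range ((↑) : ℝ → ℂ) := ⟨hwS, w.re, hw⟩
      exact hw0 (hS0 this)
    · exact h
  have hwcl : w ∈ closure C := frontier_subset_closure hwfr
  refine ⟨(S ∩ upperHalfPlaneSet) ∪ insert w C,
    union_subset hSHF (insert_subset (hSHF ⟨hwS, hwH⟩) hCF), Or.inl ⟨hyS, hyH⟩,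
    Or.inr (mem_insert_of_mem _ hzC), ?_⟩
  exact IsPreconnected.union w ⟨hwS, hwH⟩ (mem_insert _ _) hconn.isPreconnected
    (hCpre.subset_closure (subset_insert _ _) (insert_subset hwcl subset_closure))

/-- **`ℂ ∖ F^ℝ_ℍ(S)` is connected** when `S` has no real point other than `0`: it is the open
lower half-plane together with the components of `ℍ̄ ∖ S` of the real points, each hanging on
the lower half-plane at its real point. [folklore] -/
theorem isConnected_compl_twoSidedFilling (S : Set ℂ) : IsConnected (twoSidedFilling S)ᶜ := by
  have hL : IsConnected {w : ℂ | w.im < 0} :=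
    (convex_halfSpace_im_lt 0).isConnected ⟨-Complex.I, by simp⟩
  have hLsub : {w : ℂ | w.im < 0} ⊆ (twoSidedFilling S)ᶜ := fun w hw hwF ↦ by
    have := (mem_twoSidedFilling_iff.1 hwF).1
    simp only [mem_setOf_eq] at hw
    linarith
  have hI : (-Complex.I) ∈ {w : ℂ | w.im < 0} := by simp
  refine ⟨⟨-Complex.I, hLsub hI⟩, isPreconnected_of_forall (-Complex.I) fun z hz ↦ ?_⟩
  by_cases hzim : z.im < 0
  · exact ⟨{w | w.im < 0}, hLsub, hI, hzim, hL.isPreconnected⟩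
  push Not at hzim
  have h' : ¬ (0 ≤ z.im ∧ ∀ x : ℝ, z ∉ connectedComponentIn ({z : ℂ | 0 ≤ z.im} \ S) x) := by
    rwa [mem_compl_iff, mem_twoSidedFilling_iff] at hz
  push Not at h'
  obtain ⟨x, hx⟩ := h' hzim
  set Cx : Set ℂ := connectedComponentIn ({z : ℂ | 0 ≤ z.im} \ S) (x : ℂ) with hCx
  have hCsub : Cx ⊆ (twoSidedFilling S)ᶜ := fun w hw hwF ↦ (mem_twoSidedFilling_iff.1 hwF).2 x hw
  have hxC : (x : ℂ) ∈ Cx :=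
    mem_connectedComponentIn (connectedComponentIn_nonempty_iff.1 ⟨z, hx⟩)
  have hxcl : (x : ℂ) ∈ closure {w : ℂ | w.im < 0} := by
    rw [Complex.closure_setOf_im_lt]
    simp
  refine ⟨insert (x : ℂ) {w : ℂ | w.im < 0} ∪ Cx,
    union_subset (insert_subset (hCsub hxC) hLsub) hCsub, Or.inl (mem_insert_of_mem _ hI),
    Or.inr hx, ?_⟩
  exact IsPreconnected.union (x : ℂ) (mem_insert _ _) hxC
    (hL.isPreconnected.subset_closure (subset_insert _ _) (insert_subset hxcl subset_closure))
    isPreconnected_connectedComponentIn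

end Filling

/-! ### The closed filling `F^ℝ_ℍ(cl(γ(0, ∞) ∪ ⋃ X̂)) ∩ ℍ` -/

section ClosedFill

variable {κ : ℝ≥0} {ω : ℝ≥0 → ℝ} {X : Set (BubbleConfig × ℝ≥0)}

/-- The union `γ(0, ∞) ∪ ⋃ X̂` of the trace and the attached bubbles ([LSW] §7.2, p. 28), before
filling: `Ξ(κ) = F^ℝ_ℍ` of it (`sleBubbleSet_eq_twoSidedFilling`).
[cite: LawlerSchrammWerner2003Restriction, §7.2 (p. 28)] -/
def sleBubbleUnion (κ : ℝ≥0) (ω : ℝ≥0 → ℝ) (X : Set (BubbleConfig × ℝ≥0)) : Set ℂ :=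
  sleTrace κ ω '' Ioi 0 ∪ ⋃ p ∈ X, attachedBubble κ ω (p.1 : Set ℂ) p.2

/-- `Ξ(κ) = F^ℝ_ℍ(γ(0, ∞) ∪ ⋃ X̂)`. [cite: LawlerSchrammWerner2003Restriction, §7.2 (p. 28)] -/
theorem sleBubbleSet_eq_twoSidedFilling (κ : ℝ≥0) (ω : ℝ≥0 → ℝ) (X : Set (BubbleConfig × ℝ≥0)) :
    sleBubbleSet κ ω X = twoSidedFilling (sleBubbleUnion κ ω X) := rfl

/-- **The closed filling** `F^ℝ_ℍ(cl(γ(0, ∞) ∪ ⋃ X̂)) ∩ ℍ` of the trace and the attached bubbles: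
the `Ω`-valued reading of [LSW]'s `Ξ(κ)` used here (Thm. 7.3 read as in Thm. 8.4, where the
random element of `Ω₊` is `K = F^{ℝ₊}_ℍ(cl K_∞)`, p. 37). By the closedness statement of [LSW]
p. 29 ("`cl Ξ = Ξ ∪ {0}`") it coincides with `Ξ(κ)` almost surely; that statement is not used in
the tree. It always contains `Ξ(κ)` (`sleBubbleSet_subset_sleClosedBubbleSet`).
[cite: LawlerSchrammWerner2003Restriction, Thm. 7.3 (p. 29) with §8 Thm. 8.4 (p. 37)] -/
def sleClosedBubbleSet (κ : ℝ≥0) (ω : ℝ≥0 → ℝ) (X : Set (BubbleConfig × ℝ≥0)) : Set ℂ :=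
  twoSidedFilling (closure (sleBubbleUnion κ ω X)) ∩ upperHalfPlaneSet

/-- For a simple trace, `γ(0, ∞) ∪ ⋃ X̂ ⊆ ℍ` (the attached bubbles lie in `H_t ⊆ ℍ`). [folklore] -/
theorem sleBubbleUnion_subset_upperHalfPlaneSet (hγ : Loewner.IsSimpleTrace (sleTrace κ ω))
    (X : Set (BubbleConfig × ℝ≥0)) : sleBubbleUnion κ ω X ⊆ upperHalfPlaneSet := by
  rintro z (⟨t, ht, rfl⟩ | hz)
  · exact hγ.2 t ht
  · rw [mem_iUnion₂] at hz
    obtain ⟨p, -, hzp⟩ := hz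
    exact attachedBubble_subset_upperHalfPlaneSet κ ω p.1.subset_upperHalfPlaneSet p.2 hzp

/-- `γ(0, ∞) ∪ ⋃ X̂ ⊆ Ξ(κ)` when it lies in `ℍ`. [folklore] -/
theorem sleBubbleUnion_subset_sleBubbleSet (hY : sleBubbleUnion κ ω X ⊆ upperHalfPlaneSet) :
    sleBubbleUnion κ ω X ⊆ sleBubbleSet κ ω X := fun z hz ↦
  inter_subset_twoSidedFilling _ ⟨hz, le_of_lt (show 0 < z.im from hY hz)⟩

/-- **`Ξ(κ)` lies in the closed filling** (when `γ(0, ∞) ∪ ⋃ X̂ ⊆ ℍ`): `F^ℝ_ℍ` is monotone and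
`Ξ ⊆ ℍ`. [folklore] -/
theorem sleBubbleSet_subset_sleClosedBubbleSet (hY : sleBubbleUnion κ ω X ⊆ upperHalfPlaneSet) :
    sleBubbleSet κ ω X ⊆ sleClosedBubbleSet κ ω X := fun _ hz ↦
  ⟨twoSidedFilling_mono subset_closure hz, twoSidedFilling_subset_upperHalfPlaneSet hY hz⟩

/-- `γ(0, ∞) ∪ ⋃ X̂` lies in the closed filling (when it lies in `ℍ`). [folklore] -/
theorem sleBubbleUnion_subset_sleClosedBubbleSet (hY : sleBubbleUnion κ ω X ⊆ upperHalfPlaneSet) :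
    sleBubbleUnion κ ω X ⊆ sleClosedBubbleSet κ ω X :=
  (sleBubbleUnion_subset_sleBubbleSet hY).trans (sleBubbleSet_subset_sleClosedBubbleSet hY)

/-- The closed filling lies in `ℍ`. [folklore] -/
theorem sleClosedBubbleSet_subset_upperHalfPlaneSet (κ : ℝ≥0) (ω : ℝ≥0 → ℝ)
    (X : Set (BubbleConfig × ℝ≥0)) : sleClosedBubbleSet κ ω X ⊆ upperHalfPlaneSet :=
  inter_subset_right

/-- `0 ∈ cl γ(0, ∞)` for a generating curve (`γ(0) = W₀ = 0`). [folklore] -/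
theorem zero_mem_closure_image_sleTrace
    (hgen : Loewner.IsGeneratedByCurve (sleDriving κ ω) (sleTrace κ ω)) :
    (0 : ℂ) ∈ closure (sleTrace κ ω '' Ioi 0) := by
  have h0 : sleTrace κ ω 0 = 0 := by
    rw [hgen.apply_zero, sleDriving_zero, Complex.ofReal_zero]
  have hsub : sleTrace κ ω '' closure (Ioi 0) ⊆ closure (sleTrace κ ω '' Ioi 0) :=
    image_closure_subset_closure_image hgen.continuous
  refine hsub ⟨0, ?_, h0⟩
  rw [closure_Ioi' ⟨1, mem_Ioi.2 one_pos⟩]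
  exact self_mem_Ici

/-- **The closed filling belongs to `Ω`, deterministically in the sample** ([LSW] Def. 3.1 for
`F^ℝ_ℍ(cl(γ(0, ∞) ∪ ⋃ X̂)) ∩ ℍ`): if the trace is a simple path in `ℍ ∪ {0}`, no bubble sits at
time `0`, and the closure of `γ(0, ∞) ∪ ⋃ X̂` meets `ℝ` at most at `0` (the printed statement
"`cl Ξ ∩ (ℝ ∖ {0}) = ∅`" of p. 29), then the closed filling is relatively closed in `ℍ`
(`isClosed_twoSidedFilling`), connected (`isConnected_twoSidedFilling_inter_upperHalfPlaneSet`,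
`isConnected_sleTrace_union_attachedBubble`), its closure meets `ℝ` exactly at `0`, it is
unbounded (`not_isBounded_image_sleTrace`) and the complement of its closure is connected
(`isConnected_compl_twoSidedFilling`).
[cite: LawlerSchrammWerner2003Restriction, Def. 3.1 (p. 10) with Thm. 7.3 and p. 29] -/
theorem sleClosedBubbleSet_mem_restrictionConfigs (hγ : Loewner.IsSimpleTrace (sleTrace κ ω))
    (hX0 : ∀ p ∈ X, p.2 ≠ 0)
    (hreal : closure (sleBubbleUnion κ ω X) ∩ range ((↑) : ℝ → ℂ) ⊆ {0}) :
    sleClosedBubbleSet κ ω X ∈ restrictionConfigs := by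
  have hgen := isGeneratedByCurve_sleTrace_of_isSimpleTrace hγ
  set Y : Set ℂ := sleBubbleUnion κ ω X with hYdef
  set S : Set ℂ := closure Y with hSdef
  have hYH : Y ⊆ upperHalfPlaneSet := sleBubbleUnion_subset_upperHalfPlaneSet hγ X
  have hSH : S ⊆ {z : ℂ | 0 ≤ z.im} := by
    refine closure_minimal (fun z hz ↦ ?_) (isClosed_le continuous_const Complex.continuous_im)
    exact le_of_lt (show 0 < z.im from hYH hz)
  have hS : IsClosed S := isClosed_closure
  have hF : IsClosed (twoSidedFilling S) := isClosed_twoSidedFilling hS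
  have hK : sleClosedBubbleSet κ ω X = twoSidedFilling S ∩ upperHalfPlaneSet := rfl
  have hYconn : IsConnected Y := isConnected_sleTrace_union_attachedBubble hγ hX0
  have hYK : Y ⊆ sleClosedBubbleSet κ ω X := sleBubbleUnion_subset_sleClosedBubbleSet hYH
  have h0H : (0 : ℂ) ∉ upperHalfPlaneSet := fun h ↦ by
    have : (0 : ℝ) < (0 : ℂ).im := h
    simp at this
  -- the closure of the closed filling is the filling
  have hcl_sub : closure (sleClosedBubbleSet κ ω X) ⊆ twoSidedFilling S := by
    rw [hK]
    exact closure_minimal inter_subset_left hF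
  have h0cl : (0 : ℂ) ∈ closure (sleClosedBubbleSet κ ω X) :=
    closure_mono ((subset_union_left).trans hYK) (zero_mem_closure_image_sleTrace hgen)
  have hcl_eq : closure (sleClosedBubbleSet κ ω X) = twoSidedFilling S := by
    refine Subset.antisymm hcl_sub fun z hz ↦ ?_
    rcases (show (0 : ℝ) ≤ z.im from (mem_twoSidedFilling_iff.1 hz).1).eq_or_lt with h | h
    · have hzre : ((z.re : ℝ) : ℂ) = z := Complex.ext (by simp) (by simp [← h])
      have hzS : z ∈ S ∩ range ((↑) : ℝ → ℂ) := by
        rw [← hzre] at hz ⊢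
        exact ⟨mem_of_ofReal_mem_twoSidedFilling hz, z.re, rfl⟩
      rw [show z = 0 from hreal hzS]
      exact h0cl
    · exact subset_closure ⟨hz, h⟩
  refine ⟨?_, ?_, ?_, ?_, ?_⟩
  · -- relatively closed in `ℍ`
    refine Subset.antisymm (fun z hz ↦ ⟨hcl_sub hz.1, hz.2⟩) fun z hz ↦ ⟨subset_closure hz, hz.2⟩
  · -- connected
    rw [hK]
    refine isConnected_twoSidedFilling_inter_upperHalfPlaneSet hS hSH ?_ hreal
    have h1 : Y ⊆ S ∩ upperHalfPlaneSet := fun z hz ↦ ⟨subset_closure hz, hYH hz⟩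
    have h2 : S ∩ upperHalfPlaneSet ⊆ closure Y := inter_subset_left
    exact ⟨hYconn.nonempty.mono h1, hYconn.isPreconnected.subset_closure h1 h2⟩
  · -- the closure meets `ℝ` exactly at `0`
    refine Subset.antisymm ?_ ?_
    · rintro z ⟨hzcl, x, rfl⟩
      exact hreal ⟨mem_of_ofReal_mem_twoSidedFilling (hcl_sub hzcl), x, rfl⟩
    · intro z hz
      rw [mem_singleton_iff] at hz
      subst hz
      exact ⟨h0cl, 0, Complex.ofReal_zero⟩
  · -- unbounded
    exact fun hb ↦ not_isBounded_image_sleTrace hgen (hb.subset ((subset_union_left).trans hYK))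
  · -- the complement of the closure is connected
    rw [hcl_eq]
    exact isConnected_compl_twoSidedFilling S

end ClosedFill

end Literature.Probability.RandomPlanarGeometry

end
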